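import Mathlib
import Literature.NumberTheory.Irrationality.RhinViola2001.GroupStructure
import HarnessLib

/-!
# Rhin–Viola 2001, Theorem 2.1 — I: the combinatorial bookkeeping of the printed proof

Topic `Literature/NumberTheory/Irrationality/RhinViola2001`. First of three files (cell `zeta5-irr`, seat zi-lit g11,
2026-08-27) DISCHARGING the named fact `theorem21` of `GroupStructure.lean`: G. Rhin, C. Viola, *The group structure
for ζ(3)*, Acta Arith. **97** (2001) 269–293 [RhinViola2001], **Theorem 2.1** (pp. 273–274) — for non-negative
integers `h, j, k, l, m, q, r, s` with `h + m = k + r`, `j + q = l + s` the integral (2.1) satisfies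
`I(h,j,k,l,m,q,r,s) = a + 2bζ(3)` with `b ∈ ℤ` and `d_M d_N d_Q a ∈ ℤ`, `M ≥ N ≥ Q` the three successive maxima of
the eight integers (2.8) — by the PRINTED proof (pp. 274–275, held text `paper:doi-10-4064-aa97-3-6`, read on the
page): a finite descent along the linear decomposition

  (2.10) `I(h,j,k,l,m,q,r,s) = I(h,j,k,l−1,m−1,q−1,r−1,s) − I(h+1,j,k,l−1,m−1,q−1,r,s) − I(h,j+1,k,l,m−1,q−1,r−1,s)`

(from `(1−x)(1−z) = 1−x−(1−x)z`), the permutations `ϑ = (h j k l m q r s)` and `σ = (h k)(l s)(m r)` (both act on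
the integrals by THEOREMS of the tree: `ThetaInvariance.I_theta`, `invariance_sigma`), the "polynomial case"
`q + h − r < 0` and the base case (2.11) `I(h,0,h,0,h,0,h,0) = −2Σ_{ν≤h} ν⁻³ + 2ζ(3)` ("Lemma 1 of [Beukers]").

This file holds the part of the argument that involves NO analysis (everything PROVED, no definition of
mathematical content beyond plumbing, no named fact):

* `Theorem21.Dom L M N Q` — the counting form of "`M, N, Q` dominate the successive maxima of `L`": no entry of
  `L` exceeds `M`, at most one exceeds `N`, at most two exceed `Q`. It is invariant under permutations of `L`
  (`dom_perm`), monotone under entrywise decrease (`dom_mono` — this is the sentence "for each of these three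
  integrals at least two of the integers (2.8) are less than the corresponding integers for `I` and none is
  greater, so that the integers `M`, `N` and `Q` associated with any one of the three integrals do not exceed,
  respectively, the integers `M`, `N` and `Q` for `I`", p. 274), satisfied by the successive maxima themselves
  (`dom_succMax`), and it yields `d_x d_y d_z ∣ d_M d_N d_Q` for any three entries `x, y, z` of `L` "occurring
  in distinct places in the list" (`dvd_of_dom`; p. 274, the polynomial case, and p. 275, (2.11)).
* the three parameter sets of (2.10) (`childA`, `childB`, `childC`), their balance, non-negativity, the drop of
  `h+j+k+l+m+q+r+s` (`total`), and the entrywise comparison of their integers (2.8) with those of `I`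
  (`S_childA_le`, …); the rotations `rot i = ϑ^i` and the lists (2.8) of `ϑP`, `σP` as permutations of that of
  `P` (`S_theta_perm`, `S_sigma_perm`); the base parameters `(t,0,t,0,t,0,t,0)` of (2.11) (`baseP`).
* `Theorem21.Good D v` — "`v = a + 2bζ(3)` with `b ∈ ℤ`, `a ∈ ℚ`, `D a ∈ ℤ`", closed under differences and
  weakening of `D`.

The analysis (integrability on the cube, (2.10) as an identity of integrals, the polynomial case, (2.11)) is
`Theorem21Integrals.lean`; the induction and `theorem21_holds` are `Theorem21Proofs.lean`.

HONEST FRAMING (cells pub-zeta5 / zeta5-irr): the arithmetic of Rhin–Viola's `ζ(3)` integrals AS PRINTED in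
2001; nothing here concerns `ζ(5)`; records in print unmoved.
-/

namespace Literature.NumberTheory.Irrationality.RhinViola2001

namespace Theorem21

open Literature.NumberTheory.Transcendental (zetaValue)
open scoped List

/-! ### `d_n = lcm(1,…,n)`: monotonicity -/

/-- `lcm(1,…,m) ∣ lcm(1,…,n)` for `m ≤ n`. [folklore] -/
private theorem lcmUpto_dvd_lcmUpto_of_le {m n : ℕ} (h : m ≤ n) : Nat.lcmUpto m ∣ Nat.lcmUpto n := by
  apply Finset.lcm_dvd
  intro i hi
  exact Finset.dvd_lcm (by rw [Finset.mem_Icc] at hi ⊢; omega)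

/-- `d` (= `d_n` with `d_n = 1` for `n ≤ 0`) is monotone for divisibility. [cite: RhinViola2001, §2 p. 271] -/
theorem d_dvd_d_of_le {a b : ℤ} (h : a ≤ b) : d a ∣ d b :=
  lcmUpto_dvd_lcmUpto_of_le (Int.toNat_le_toNat h)

/-- `d_t = lcm(1,…,t)` at a natural number `t` ("`d_n = l.c.m.{1, …, n}` for `n ≥ 1`", `d_0 = 1`).
[cite: RhinViola2001, §2 p. 271 (definition of `d_n`)] -/
theorem d_natCast (t : ℕ) : d (t : ℤ) = Nat.lcmUpto t := by
  simp [d]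

/-! ### The counting form of "dominating the three successive maxima" -/

/-- `Dom L M N Q`: no entry of `L` exceeds `M`, at most one entry exceeds `N`, at most two entries exceed `Q`.
For `M = max L`, `N = max′ L`, `Q = max″ L` this holds (`dom_succMax`); it is the form in which the successive
maxima enter the printed proof. [cite: RhinViola2001, §2 p. 273 (max, max′, max″) and Theorem 2.1] -/
def Dom (L : List ℤ) (M N Q : ℤ) : Prop :=
  L.countP (fun x => decide (M < x)) = 0 ∧ L.countP (fun x => decide (N < x)) ≤ 1 ∧
    L.countP (fun x => decide (Q < x)) ≤ 2

/-- `Dom` depends only on the multiset of entries ("`M`, `N` and `Q` are invariant under the actions of `ϑ` and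
`σ`", p. 274). [cite: RhinViola2001, §2 p. 274] -/
theorem dom_perm {L L' : List ℤ} (h : L.Perm L') {M N Q : ℤ} : Dom L M N Q ↔ Dom L' M N Q := by
  unfold Dom
  rw [h.countP_eq, h.countP_eq, h.countP_eq]

/-- Counting entries above a threshold is monotone under entrywise decrease. [folklore] -/
private theorem countP_lt_mono {L L' : List ℤ} (h : List.Forall₂ (· ≤ ·) L' L) (c : ℤ) :
    L'.countP (fun x => decide (c < x)) ≤ L.countP (fun x => decide (c < x)) := by
  induction h with
  | nil => simp
  | @cons a' a L' L hab _ ih =>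
    rw [List.countP_cons, List.countP_cons]
    have hle : (if decide (c < a') = true then 1 else 0) ≤ (if decide (c < a) = true then 1 else 0) := by
      by_cases h1 : c < a'
      · have h2 : c < a := lt_of_lt_of_le h1 hab
        simp [h1, h2]
      · simp [h1]
    omega

/-- "for each of these three integrals at least two of the integers (2.8) are less than the corresponding
integers for `I` and none is greater, so that the integers `M`, `N` and `Q` associated with any one of the three
integrals do not exceed, respectively, the integers `M`, `N` and `Q` for `I`": `Dom` is inherited by entrywise
smaller lists. [cite: RhinViola2001, §2 p. 274–275] -/
theorem dom_mono {L L' : List ℤ} (h : List.Forall₂ (· ≤ ·) L' L) {M N Q : ℤ} (hD : Dom L M N Q) :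
    Dom L' M N Q := by
  obtain ⟨h0, h1, h2⟩ := hD
  refine ⟨?_, (countP_lt_mono h N).trans h1, (countP_lt_mono h Q).trans h2⟩
  have := countP_lt_mono h M
  omega

/-- At most `i` entries of a list exceed its `i`-th successive maximum (`i` within the length).
[cite: RhinViola2001, §2 p. 273 (definition of the successive maxima)] -/
theorem countP_succMax_lt_le (L : List ℤ) {i : ℕ} (hi : i < L.length) :
    L.countP (fun x => decide (succMax L i < x)) ≤ i := by
  set S := L.insertionSort (· ≥ ·) with hS
  have hperm : S.Perm L := List.perm_insertionSort _ L
  have hlen : S.length = L.length := hperm.length_eq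
  have hsort : S.Pairwise (· ≥ ·) := (List.sortedGE_insertionSort (l := L)).pairwise
  have hiS : i < S.length := by omega
  have hget : succMax L i = S[i] := by
    unfold succMax
    exact List.getD_eq_getElem S 0 hiS
  have key : ∀ t : ℤ, t = S[i] → S.countP (fun x => decide (t < x)) ≤ i := by
    intro t ht
    have h1 : (S.drop i).countP (fun x => decide (t < x)) = 0 := by
      rw [List.countP_eq_zero]
      intro y hy
      rw [List.drop_eq_getElem_cons hiS, List.mem_cons] at hy
      have hy' : y ≤ S[i] := by
        rcases hy with rfl | hy
        · exact le_rfl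
        · have hp : (S.drop i).Pairwise (· ≥ ·) := hsort.sublist (List.drop_sublist i S)
          rw [List.drop_eq_getElem_cons hiS, List.pairwise_cons] at hp
          exact hp.1 y hy
      simpa [ht] using hy'
    have h2 : (S.take i).countP (fun x => decide (t < x)) ≤ i :=
      List.countP_le_length.trans (by rw [List.length_take]; exact min_le_left _ _)
    calc S.countP (fun x => decide (t < x))
        = (S.take i ++ S.drop i).countP (fun x => decide (t < x)) := by rw [List.take_append_drop]
      _ = (S.take i).countP (fun x => decide (t < x)) + (S.drop i).countP (fun x => decide (t < x)) :=
          List.countP_append ..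
      _ ≤ i := by rw [h1, add_zero]; exact h2
  rw [← hperm.countP_eq, hget]
  exact key _ rfl

/-- The three successive maxima `max L, max′ L, max″ L` dominate `L` in the counting sense (lists of length `≥ 3`).
[cite: RhinViola2001, §2 p. 273] -/
theorem dom_succMax (L : List ℤ) (hL : 3 ≤ L.length) :
    Dom L (succMax L 0) (succMax L 1) (succMax L 2) :=
  ⟨Nat.le_zero.1 (countP_succMax_lt_le L (by omega)), countP_succMax_lt_le L (by omega),
    countP_succMax_lt_le L (by omega)⟩

/-- An entry of a dominated list is `≤ M`. [folklore] -/
private theorem le_of_dom_mem {L : List ℤ} {M N Q : ℤ} (hD : Dom L M N Q) {x : ℤ} (hx : x ∈ L) : x ≤ M := by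
  have h := (List.countP_eq_zero.1 hD.1) x hx
  simpa using h

/-- Two entries `x ≥ y` at distinct places of a dominated list: `y ≤ N`. [folklore] -/
private theorem le_of_dom_two {L : List ℤ} {M N Q : ℤ} (hD : Dom L M N Q) {x y : ℤ} (h : [x, y] <+~ L)
    (hxy : y ≤ x) : y ≤ N := by
  by_contra hN
  have hy : N < y := lt_of_not_ge hN
  have hx : N < x := lt_of_lt_of_le hy hxy
  have h2 : [x, y].countP (fun t => decide (N < t)) = 2 := by simp [hx, hy]
  have := h.countP_le (fun t => decide (N < t))
  have := hD.2.1
  omega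

/-- Three entries `x ≥ y ≥ z` at distinct places of a dominated list: `z ≤ Q`. [folklore] -/
private theorem le_of_dom_three {L : List ℤ} {M N Q : ℤ} (hD : Dom L M N Q) {x y z : ℤ} (h : [x, y, z] <+~ L)
    (hxy : y ≤ x) (hyz : z ≤ y) : z ≤ Q := by
  by_contra hQ
  have hz : Q < z := lt_of_not_ge hQ
  have hy : Q < y := lt_of_lt_of_le hz hyz
  have hx : Q < x := lt_of_lt_of_le hy hxy
  have h3 : [x, y, z].countP (fun t => decide (Q < t)) = 3 := by simp [hx, hy, hz]
  have := h.countP_le (fun t => decide (Q < t))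
  have := hD.2.2
  omega

/-- Sorted form of `dvd_of_dom`. [folklore] -/
private theorem dvd_of_dom_sorted {L : List ℤ} {M N Q : ℤ} (hD : Dom L M N Q) {x y z : ℤ} (h : [x, y, z] <+~ L)
    (hxy : y ≤ x) (hyz : z ≤ y) : d x * d y * d z ∣ d M * d N * d Q := by
  have hxL : x ∈ L := h.subset (by simp)
  have h2 : [x, y] <+~ L := (List.sublist_append_left [x, y] [z]).subperm.trans h
  exact mul_dvd_mul (mul_dvd_mul (d_dvd_d_of_le (le_of_dom_mem hD hxL))
    (d_dvd_d_of_le (le_of_dom_two hD h2 hxy))) (d_dvd_d_of_le (le_of_dom_three hD h hxy hyz))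

/-- "Since `r+l−q`, `m+s−q` and `j+r−h` occur in distinct places in the list (2.8), we get `d_M d_N d_Q I ∈ ℤ`":
for any three entries `x, y, z` of a dominated list standing at distinct places, `d_x d_y d_z ∣ d_M d_N d_Q`.
[cite: RhinViola2001, §2 p. 274 (proof of Theorem 2.1, first paragraph) and p. 275 ((2.11): `d_M d_N d_Q a = d_h³ a`)] -/
theorem dvd_of_dom {L : List ℤ} {M N Q : ℤ} (hD : Dom L M N Q) {x y z : ℤ} (h : [x, y, z] <+~ L) :
    d x * d y * d z ∣ d M * d N * d Q := by
  -- the six orderings of `x, y, z`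
  have pyxz : [y, x, z].Perm [x, y, z] := List.Perm.swap x y [z]
  have pxzy : [x, z, y].Perm [x, y, z] := (List.Perm.swap y z []).cons x
  have pzyx : [z, y, x].Perm [x, y, z] := by simpa using List.reverse_perm [x, y, z]
  have pyzx : [y, z, x].Perm [x, y, z] := ((List.Perm.swap x z []).cons y).trans pyxz
  have pzxy : [z, x, y].Perm [x, y, z] := (List.Perm.swap x z [y]).trans pxzy
  rcases le_total y x with hxy | hxy <;> rcases le_total z y with hyz | hyz
  · exact dvd_of_dom_sorted hD h hxy hyz
  · rcases le_total z x with hxz | hxz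
    · have := dvd_of_dom_sorted hD (pxzy.subperm_right.2 h) hxz hyz
      calc d x * d y * d z = d x * d z * d y := by ring
        _ ∣ _ := this
    · have := dvd_of_dom_sorted hD (pzxy.subperm_right.2 h) hxz hxy
      calc d x * d y * d z = d z * d x * d y := by ring
        _ ∣ _ := this
  · rcases le_total z x with hxz | hxz
    · have := dvd_of_dom_sorted hD (pyxz.subperm_right.2 h) hxy hxz
      calc d x * d y * d z = d y * d x * d z := by ring
        _ ∣ _ := this
    · have := dvd_of_dom_sorted hD (pyzx.subperm_right.2 h) hyz hxz
      calc d x * d y * d z = d y * d z * d x := by ring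
        _ ∣ _ := this
  · have := dvd_of_dom_sorted hD (pzyx.subperm_right.2 h) hyz hxy
    calc d x * d y * d z = d z * d y * d x := by ring
      _ ∣ _ := this

/-! ### The parameters: total weight, rotations, the three children of (2.10), the base case -/

/-- `h + j + k + l + m + q + r + s` (twice the sum of (2.8); the quantity that strictly decreases along (2.10):
"the sum of the integers (2.8) for each of the three integrals is strictly less than the sum of (2.8) for `I`").
[cite: RhinViola2001, §2 p. 275] -/
def total (P : Params) : ℤ := P.h + P.j + P.k + P.l + P.m + P.q + P.r + P.s

/-- `ϑ` preserves the total weight. [cite: RhinViola2001, §2 p. 272] -/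
theorem total_theta (P : Params) : total (theta P) = total P := by
  simp only [total, theta]; ring

/-- `σ` preserves the total weight. [cite: RhinViola2001, §2 p. 272] -/
theorem total_sigma (P : Params) : total (sigma P) = total P := by
  simp only [total, sigma]; ring

/-- The total weight of non-negative parameters is a non-negative integer (so that the descent along (2.10) ends
"in finitely many steps"). [cite: RhinViola2001, §2 p. 275] -/
theorem total_nonneg {P : Params} (hP : P.Nonneg) : 0 ≤ total P := by
  obtain ⟨_, _, _, _, _, _, _, _⟩ := hP
  unfold total; omega

/-- A cyclic rotation of an eight-entry list is a permutation of it (plumbing). [folklore] -/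
private theorem perm_rotate8 (a b c d e f g h : ℤ) :
    ([b, c, d, e, f, g, h, a] : List ℤ).Perm [a, b, c, d, e, f, g, h] := by
  simpa using (List.perm_append_comm : ([b, c, d, e, f, g, h] ++ [a]).Perm ([a] ++ [b, c, d, e, f, g, h]))

/-- The reflection `σ` of the octagon on an eight-entry list is a permutation of it (plumbing). [folklore] -/
private theorem perm_sigma8 (a b c d e f g h : ℤ) :
    ([c, b, a, h, g, f, e, d] : List ℤ).Perm [a, b, c, d, e, f, g, h] := by
  have h1 : ([c, b, a, h, g, f, e, d] : List ℤ).Perm [d, e, f, g, h, a, b, c] := by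
    simpa using List.reverse_perm [d, e, f, g, h, a, b, c]
  exact h1.trans ((perm_rotate8 c d e f g h a b).trans
    ((perm_rotate8 b c d e f g h a).trans (perm_rotate8 a b c d e f g h)))

/-- The integers (2.8) of `ϑP` are those of `P`, rotated: "`ϑ` and `σ` permute the integers (2.8)".
[cite: RhinViola2001, §2 p. 273] -/
theorem S_theta_perm (P : Params) : (theta P).S.Perm P.S := by
  rw [Params.S, Params.S, aux_theta]
  simp only [Params.toList, theta]
  exact perm_rotate8 _ _ _ _ _ _ _ _

/-- The integers (2.8) of `σP` are those of `P`, permuted by `(h' k')(l' s')(m' r')`.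
[cite: RhinViola2001, §2 p. 273] -/
theorem S_sigma_perm {P : Params} (hP : P.Balanced) : (sigma P).S.Perm P.S := by
  rw [Params.S, Params.S, aux_sigma hP]
  simp only [Params.toList, sigma]
  exact perm_sigma8 _ _ _ _ _ _ _ _

/-- The lists (2.8) have eight entries. [cite: RhinViola2001, §2 (2.8)] -/
theorem length_S (P : Params) : P.S.length = 8 := by
  simp [Params.S, Params.toList]

/-- `ϑ^i` on the parameters ("a suitable power of the permutation `ϑ`", p. 274). [cite: RhinViola2001, §2 p. 274] -/
def rot : ℕ → Params → Params
  | 0, P => P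
  | i + 1, P => theta (rot i P)

/-- `ϑ^i` preserves (2.2)–(2.3). [cite: RhinViola2001, §2 p. 273] -/
theorem balanced_rot {P : Params} (hP : P.Balanced) : ∀ i, (rot i P).Balanced
  | 0 => hP
  | i + 1 => balanced_theta (balanced_rot hP i)

/-- `ϑ^i` preserves non-negativity. [cite: RhinViola2001, §2 p. 272] -/
theorem nonneg_rot {P : Params} (hP : P.Nonneg) : ∀ i, (rot i P).Nonneg
  | 0 => hP
  | i + 1 => nonneg_theta (nonneg_rot hP i)

/-- `ϑ^i` preserves the total weight. [cite: RhinViola2001, §2 p. 272] -/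
theorem total_rot (P : Params) : ∀ i, total (rot i P) = total P
  | 0 => rfl
  | i + 1 => by rw [rot, total_theta, total_rot P i]

/-- The integers (2.8) of `ϑ^i P` are a permutation of those of `P`. [cite: RhinViola2001, §2 p. 273] -/
theorem S_rot_perm (P : Params) : ∀ i, (rot i P).S.Perm P.S
  | 0 => List.Perm.refl _
  | i + 1 => (S_theta_perm _).trans (S_rot_perm P i)

/-- The first parameter set of (2.10): `(h, j, k, l−1, m−1, q−1, r−1, s)`. [cite: RhinViola2001, §2 (2.10)] -/
def childA (P : Params) : Params := ⟨P.h, P.j, P.k, P.l - 1, P.m - 1, P.q - 1, P.r - 1, P.s⟩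

/-- The second parameter set of (2.10): `(h+1, j, k, l−1, m−1, q−1, r, s)`. [cite: RhinViola2001, §2 (2.10)] -/
def childB (P : Params) : Params := ⟨P.h + 1, P.j, P.k, P.l - 1, P.m - 1, P.q - 1, P.r, P.s⟩

/-- The third parameter set of (2.10): `(h, j+1, k, l, m−1, q−1, r−1, s)`. [cite: RhinViola2001, §2 (2.10)] -/
def childC (P : Params) : Params := ⟨P.h, P.j + 1, P.k, P.l, P.m - 1, P.q - 1, P.r - 1, P.s⟩

/-- "each of the three integrals thus obtained satisfies (2.2) and (2.3)". [cite: RhinViola2001, §2 p. 274] -/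
theorem balanced_childA {P : Params} (hP : P.Balanced) : (childA P).Balanced := by
  obtain ⟨h1, h2⟩ := hP
  constructor <;> simp only [childA] <;> omega

/-- "each of the three integrals thus obtained satisfies (2.2) and (2.3)". [cite: RhinViola2001, §2 p. 274] -/
theorem balanced_childB {P : Params} (hP : P.Balanced) : (childB P).Balanced := by
  obtain ⟨h1, h2⟩ := hP
  constructor <;> simp only [childB] <;> omega

/-- "each of the three integrals thus obtained satisfies (2.2) and (2.3)". [cite: RhinViola2001, §2 p. 274] -/
theorem balanced_childC {P : Params} (hP : P.Balanced) : (childC P).Balanced := by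
  obtain ⟨h1, h2⟩ := hP
  constructor <;> simp only [childC] <;> omega

/-- Under `lmqr > 0` the first child has non-negative parameters. [cite: RhinViola2001, §2 p. 274] -/
theorem nonneg_childA {P : Params} (hP : P.Nonneg) (hl : 1 ≤ P.l) (hm : 1 ≤ P.m) (hq : 1 ≤ P.q)
    (hr : 1 ≤ P.r) : (childA P).Nonneg := by
  obtain ⟨_, _, _, _, _, _, _, _⟩ := hP
  simp only [Params.Nonneg, childA]; omega

/-- Under `lmqr > 0` the second child has non-negative parameters. [cite: RhinViola2001, §2 p. 274] -/
theorem nonneg_childB {P : Params} (hP : P.Nonneg) (hl : 1 ≤ P.l) (hm : 1 ≤ P.m) (hq : 1 ≤ P.q) :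
    (childB P).Nonneg := by
  obtain ⟨_, _, _, _, _, _, _, _⟩ := hP
  simp only [Params.Nonneg, childB]; omega

/-- Under `lmqr > 0` the third child has non-negative parameters. [cite: RhinViola2001, §2 p. 274] -/
theorem nonneg_childC {P : Params} (hP : P.Nonneg) (hm : 1 ≤ P.m) (hq : 1 ≤ P.q) (hr : 1 ≤ P.r) :
    (childC P).Nonneg := by
  obtain ⟨_, _, _, _, _, _, _, _⟩ := hP
  simp only [Params.Nonneg, childC]; omega

/-- The total weight drops by `4` for the first child. [cite: RhinViola2001, §2 p. 275] -/
theorem total_childA (P : Params) : total (childA P) = total P - 4 := by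
  simp only [total, childA]; ring

/-- The total weight drops by `2` for the second child. [cite: RhinViola2001, §2 p. 275] -/
theorem total_childB (P : Params) : total (childB P) = total P - 2 := by
  simp only [total, childB]; ring

/-- The total weight drops by `2` for the third child. [cite: RhinViola2001, §2 p. 275] -/
theorem total_childC (P : Params) : total (childC P) = total P - 2 := by
  simp only [total, childC]; ring

/-- The integers (2.8) of the first child are `(h'−1, j'−1, k', l'−1, m', q', r'−1, s')`: entrywise `≤` those of `P`.
[cite: RhinViola2001, §2 p. 274] -/
theorem S_childA_le (P : Params) : List.Forall₂ (· ≤ ·) (childA P).S P.S := by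
  simp only [Params.S, Params.aux, Params.toList, childA, List.forall₂_cons, List.Forall₂.nil, and_true]
  omega

/-- The integers (2.8) of the second child are `(h', j'−1, k', l', m', q', r', s'−1)`: entrywise `≤` those of `P`.
[cite: RhinViola2001, §2 p. 274] -/
theorem S_childB_le (P : Params) : List.Forall₂ (· ≤ ·) (childB P).S P.S := by
  simp only [Params.S, Params.aux, Params.toList, childB, List.forall₂_cons, List.Forall₂.nil, and_true]
  omega

/-- The integers (2.8) of the third child are `(h'−1, j', k'−1, l', m', q', r', s')`: entrywise `≤` those of `P`.
[cite: RhinViola2001, §2 p. 274] -/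
theorem S_childC_le (P : Params) : List.Forall₂ (· ≤ ·) (childC P).S P.S := by
  simp only [Params.S, Params.aux, Params.toList, childC, List.forall₂_cons, List.Forall₂.nil, and_true]
  omega

/-- The parameters `(t, 0, t, 0, t, 0, t, 0)` of the base case (2.11) ("`h = k = m = r`", `j = q = l = s = 0`).
[cite: RhinViola2001, §2 (2.11)] -/
def baseP (t : ℤ) : Params := ⟨t, 0, t, 0, t, 0, t, 0⟩

/-- The base parameters satisfy (2.2)–(2.3). [cite: RhinViola2001, §2 (2.11)] -/
theorem balanced_baseP (t : ℤ) : (baseP t).Balanced := by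
  constructor <;> simp [baseP]

/-- "for the integral (2.11), four of the integers (2.8) are equal to `h` and the other four vanish".
[cite: RhinViola2001, §2 p. 275] -/
theorem S_baseP (t : ℤ) : (baseP t).S = [t, 0, t, 0, t, 0, t, 0] := by
  simp [Params.S, Params.aux, Params.toList, baseP]

/-- Three of the four entries `t` of the list (2.8) of the base parameters stand at distinct places.
[cite: RhinViola2001, §2 p. 275] -/
theorem subperm_S_baseP (t : ℤ) : [t, t, t] <+~ (baseP t).S := by
  rw [S_baseP]
  have s : [t, t, t] <+ [t, 0, t, 0, t, 0, t, 0] :=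
    (((((List.nil_sublist [(0 : ℤ), t, 0]).cons_cons t).cons 0).cons_cons t).cons 0).cons_cons t
  exact s.subperm

/-- In the list `(h', j', k', l', m', q', r', s')` the entries `j', m', r'` stand at distinct places ("`r+l−q`,
`m+s−q` and `j+r−h` occur in distinct places in the list (2.8)"). [cite: RhinViola2001, §2 p. 274] -/
theorem subperm_S_jmr (P : Params) : [P.aux.j, P.aux.m, P.aux.r] <+~ P.S := by
  have s : [P.aux.j, P.aux.m, P.aux.r] <+
      [P.aux.h, P.aux.j, P.aux.k, P.aux.l, P.aux.m, P.aux.q, P.aux.r, P.aux.s] :=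
    (((((List.nil_sublist [P.aux.s]).cons_cons P.aux.r).cons P.aux.q).cons_cons P.aux.m).cons P.aux.l |>.cons
      P.aux.k).cons_cons P.aux.j |>.cons P.aux.h
  exact s.subperm

/-! ### "`= a + 2bζ(3)` with `D a ∈ ℤ`, `b ∈ ℤ`" -/

/-- `Good D v`: `v = a + 2bζ(3)` with `a ∈ ℚ`, `b ∈ ℤ` and `D a ∈ ℤ` — the conclusion (2.9) of Theorem 2.1 with the
denominator `D`. [cite: RhinViola2001, Theorem 2.1 (2.9)] -/
def Good (D : ℕ) (v : ℝ) : Prop :=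
  ∃ (a : ℚ) (b : ℤ), v = a + 2 * b * zetaValue 3 ∧ ∃ A : ℤ, (D : ℚ) * a = A

/-- Weakening the denominator `D ∣ D'` ("the integers `M`, `N` and `Q` associated with any one of the three integrals
do not exceed, respectively, the integers `M`, `N` and `Q` for `I`. Thus if Theorem 2.1 holds for the three
integrals, it also holds for `I`"). [cite: RhinViola2001, §2 pp. 274–275] -/
theorem Good.mono {D D' : ℕ} {v : ℝ} (h : Good D v) (hD : D ∣ D') : Good D' v := by
  obtain ⟨a, b, hv, A, hA⟩ := h
  obtain ⟨c, rfl⟩ := hD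
  refine ⟨a, b, hv, c * A, ?_⟩
  push_cast
  rw [← hA]; ring

/-- Differences ("a linear combination with integer coefficients of integrals", p. 275). [cite: RhinViola2001, §2 p. 275] -/
theorem Good.sub {D : ℕ} {v w : ℝ} (hv : Good D v) (hw : Good D w) : Good D (v - w) := by
  obtain ⟨a, b, hv, A, hA⟩ := hv
  obtain ⟨a', b', hw, A', hA'⟩ := hw
  refine ⟨a - a', b - b', ?_, A - A', ?_⟩
  · rw [hv, hw]; push_cast; ring
  · push_cast; rw [mul_sub, hA, hA']

/-- A value `v` with `D v ∈ ℤ` is good with `b = 0` ("so that (2.9) holds with `b = 0`", p. 274).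
[cite: RhinViola2001, §2 p. 274] -/
theorem good_of_mul_eq_int {D : ℕ} (hD : D ≠ 0) {v : ℝ} {A : ℤ} (h : (D : ℝ) * v = A) : Good D v := by
  refine ⟨(A : ℚ) / D, 0, ?_, A, ?_⟩
  · have hD' : (D : ℝ) ≠ 0 := by exact_mod_cast hD
    push_cast
    field_simp
    linarith [h]
  · have hD' : (D : ℚ) ≠ 0 := by exact_mod_cast hD
    field_simp

end Theorem21

end Literature.NumberTheory.Irrationality.RhinViola2001
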